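import Literature.NumberTheory.EllipticCurves.ZpExtensionEisensteinH1Data
import Literature.NumberTheory.GaloisRepresentations.GaloisCohomologyScalarAction
import HarnessLib

/-!
# The INHABITANT of `ZpExtension.EisensteinH1Data`: `lim_k H¹(K, M_k ⊗ A_{m,k}(ψ))` as the `Λ`-module of
# compatible families of classes, `Λ` acting through the functorial coefficient action `H¹([f] • ·)`
# (definitions with bodies + theorems; no named fact, no instance on existing types, no notation)

Topic `NumberTheory/EllipticCurves` (companion of `ZpExtensionEisensteinH1Data`; consumer of
`GaloisRepresentations/GaloisCohomologyScalarAction` — the functorial `R`-action on `H¹`).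

`ZpExtension.EisensteinH1Data κ ρ t hm` (p637499) PINS Howard's `H¹(K, T_𝔮) = lim_k H¹(K, T_𝔮/p^k T_𝔮)` at the
Eisenstein prime `𝔮 = (T^m + p)` [Howard 2004, §2.2, Def. 2.2.3] by its projections; this file CONSTRUCTS a term:

* `ZpExtension.isScalarLinear_eisensteinTwist` — each level `M_k ⊗ A_{m,k}(ψ)` is an `A_{m,k}`-linear discrete
  Galois module (`eisensteinTwist_apply_smul`), and `scalarIntertwining … c = eisensteinTwistSMulHom … c` (`rfl`);
* `ZpExtension.map_eisensteinTwistReduce_scalarMapH1` — the SEMILINEAR naturality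
  `H¹(red) (H¹([g]_{k'} •) x) = H¹([g]_k •) (H¹(red) x)` for the reductions `T_𝔮/p^{k'} → T_𝔮/p^k` (the twin of
  `galoisCohomology.map_scalarMapH1` across the change of rings `A_{m,k'} ↠ A_{m,k}`, on explicit cocycles);
* `ZpExtension.eisensteinH1LimitCarrier` — the subgroup of `Π k, H¹(K, M_k ⊗ A_{m,k}(ψ))` of families compatible
  under the successive reductions; `ZpExtension.eisensteinH1LimitSMul f` — the componentwise action of
  `f ∈ Λ` by `H¹([f]_k •)` (it preserves compatibility); `ZpExtension.eisensteinH1LimitModule` — the resulting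
  `Λ`-MODULE structure (axioms from `scalarMapH1_one/_mul/_add/_zero`);
* **`ZpExtension.eisensteinH1Limit κ ρ t hm : EisensteinH1Data κ ρ t hm`** — `H :=` the carrier above, `proj k` =
  evaluation, `proj_smul` = `rfl`, `proj_reduce` = membership, `ext`/`surj` tautological — and
  `ZpExtension.nonempty_eisensteinH1Data`.

So every statement quantifying `∀ D : EisensteinH1Data …` is non-vacuous, and (by `ext`/`surj`, which make any
`D` the limit up to unique isomorphism) is a statement about Howard's `H¹(K, T_𝔮)` for `M_k = E[p^k]`.
Cell `pub/bsd-print-x9`, D1 road of the shared μ-residual (the carrier `H` of `SpecWitness`). BSD is not proved by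
any of this; nothing about Selmer groups of elliptic curves is asserted.

References: [Howard2004HeegnerKolyvagin] B. Howard, Compositio Math. 140 (2004), §2.2, Def. 2.2.3;
[SerreGaloisCohomology1997] I §2.2, §2.4, §5.1 (functoriality of `H¹` on cocycles); [NeukirchSchmidtWingberg2008]
II §7 (limits).
-/

noncomputable section

open scoped TensorProduct Topology ContRepresentation
open Field Filter CategoryTheory

universe u

namespace Literature.NumberTheory.EllipticCurves

open Literature.NumberTheory.GaloisRepresentations
open Literature.NumberTheory.GaloisRepresentations.DiscreteGaloisModule (IsScalarLinear scalarIntertwining)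
open Literature.NumberTheory.GaloisRepresentations.galoisCohomology (scalarMapH1 scalarMapH1_oneCocycleClass
  scalarCocycle scalarMapH1_one scalarMapH1_mul scalarMapH1_add scalarMapH1_zero)

namespace ZpExtension

variable {K : Type u} [Field K] {p : ℕ} [hp : Fact p.Prime] (κ : ZpExtension K p)

/-! ## §1 The levels are `A_{m,k}`-linear -/

section Level

variable {M₀ : Type u} [AddCommGroup M₀] [TopologicalSpace M₀] [DiscreteTopology M₀]
  (ρ₀ : DiscreteGaloisModule K M₀) {m : ℕ} (hm : 1 ≤ m) (k : ℕ)

/-- **`M ⊗ A_{m,k}(ψ)` is an `A_{m,k}`-linear discrete Galois module** (`IsScalarLinear` of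
`GaloisCohomologyScalarAction`; = `eisensteinTwist_apply_smul`). [cite: Howard2004HeegnerKolyvagin, §2.2 (T_𝔮 is an S_𝔮[Γ_K]-module)] -/
theorem isScalarLinear_eisensteinTwist :
    (κ.eisensteinTwist ρ₀ hm k).IsScalarLinear (IwasawaAlgebra.EisensteinCoeff p m k) :=
  fun σ c x ↦ κ.eisensteinTwist_apply_smul ρ₀ hm k σ c x

/-- The scalar endomorphism of `GaloisCohomologyScalarAction` IS `eisensteinTwistSMulHom` (same data).
[cite: Howard2004HeegnerKolyvagin, §2.2] -/
theorem scalarIntertwining_eisensteinTwist_eq (c : IwasawaAlgebra.EisensteinCoeff p m k) :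
    scalarIntertwining (κ.eisensteinTwist ρ₀ hm k) (κ.isScalarLinear_eisensteinTwist ρ₀ hm k) c =
      κ.eisensteinTwistSMulHom ρ₀ hm k c :=
  rfl

/-- Hence `H¹([c] •)` of `GaloisCohomologyScalarAction` is `galoisCohomology.map (eisensteinTwistSMulHom … c) 1`.
[cite: Howard2004HeegnerKolyvagin, §2.2] -/
theorem scalarMapH1_eisensteinTwist_eq (c : IwasawaAlgebra.EisensteinCoeff p m k) :
    scalarMapH1 (κ.eisensteinTwist ρ₀ hm k) (κ.isScalarLinear_eisensteinTwist ρ₀ hm k) c =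
      galoisCohomology.map (κ.eisensteinTwistSMulHom ρ₀ hm k c) 1 :=
  rfl

end Level

/-! ## §2 Semilinear naturality of `H¹` along the reductions -/

section Naturality

variable {M : Type u} [AddCommGroup M] [TopologicalSpace M] [DiscreteTopology M]
  {M' : Type u} [AddCommGroup M'] [TopologicalSpace M'] [DiscreteTopology M']
  {ρ : DiscreteGaloisModule K M} {ρ' : DiscreteGaloisModule K M'} {m : ℕ} (hm : 1 ≤ m) {k k' : ℕ} (hkk' : k ≤ k')

/-- **`H¹(red) ∘ H¹([g]_{k'} •) = H¹([g]_k •) ∘ H¹(red)`** for the reduction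
`red = eisensteinTwistReduce hm hkk' f : M ⊗ A_{m,k'}(ψ) → M' ⊗ A_{m,k}(ψ)` and `g ∈ Λ` — on explicit cocycle
classes both sides are `[σ ↦ red ([g]_{k'} • φ σ)] = [σ ↦ [g]_k • red (φ σ)]` (`eisensteinTwistReduce_mk_smul`).
[cite: SerreGaloisCohomology1997, I §2.4 (compatible pairs) and §5.1] [cite: Howard2004HeegnerKolyvagin, §2.2] -/
theorem map_eisensteinTwistReduce_scalarMapH1 (f : ρ.toContRepresentation →ⁱL ρ'.toContRepresentation)
    (g : IwasawaAlgebra p) (x : galoisCohomology (κ.eisensteinTwist ρ hm k') 1) :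
    galoisCohomology.map (κ.eisensteinTwistReduce hm hkk' f) 1
        (scalarMapH1 (κ.eisensteinTwist ρ hm k') (κ.isScalarLinear_eisensteinTwist ρ hm k')
          (Ideal.Quotient.mk _ g) x) =
      scalarMapH1 (κ.eisensteinTwist ρ' hm k) (κ.isScalarLinear_eisensteinTwist ρ' hm k)
        (Ideal.Quotient.mk _ g) (galoisCohomology.map (κ.eisensteinTwistReduce hm hkk' f) 1 x) := by
  obtain ⟨φ, rfl⟩ := oneCocycleClass_surjective (κ.eisensteinTwist ρ hm k').toTopRep x
  rw [scalarMapH1_oneCocycleClass]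
  change ContinuousCohomology.map _ _ 1 _ =
    scalarMapH1 (κ.eisensteinTwist ρ' hm k) (κ.isScalarLinear_eisensteinTwist ρ' hm k)
      (Ideal.Quotient.mk _ g) (ContinuousCohomology.map _ _ 1 _)
  rw [map_oneCocycleClass, map_oneCocycleClass, scalarMapH1_oneCocycleClass]
  exact congrArg _ (Subtype.ext (ContinuousMap.ext fun σ ↦
    κ.eisensteinTwistReduce_mk_smul hm hkk' f g (φ.1 σ)))

end Naturality

/-! ## §3 The limit `Λ`-module and the inhabitant of `EisensteinH1Data` -/

section Limit

variable {M : ℕ → Type u} [∀ k, AddCommGroup (M k)] [∀ k, TopologicalSpace (M k)] [∀ k, DiscreteTopology (M k)]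
  (ρ : ∀ k, DiscreteGaloisModule K (M k))
  (t : ∀ k, (ρ (k + 1)).toContRepresentation →ⁱL (ρ k).toContRepresentation) {m : ℕ} (hm : 1 ≤ m)

/-- **`lim_k H¹(K, M_k ⊗ A_{m,k}(ψ))`** as the subgroup of `Π k, H¹(K, M_k ⊗ A_{m,k}(ψ))` of families compatible
under the successive reductions (compatibility under all `k ≤ k'` follows by composition).
[cite: Howard2004HeegnerKolyvagin, §2.2 and Def. 2.2.3 (H¹(K, T_𝔮), T_𝔮 = lim T_𝔮/p^k T_𝔮)] [cite: NeukirchSchmidtWingberg2008, II §7] -/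
def eisensteinH1LimitCarrier : AddSubgroup (Π k : ℕ, galoisCohomology (κ.eisensteinTwist (ρ k) hm k) 1) where
  carrier := {x | ∀ k, galoisCohomology.map (κ.eisensteinTwistReduce hm (Nat.le_succ k) (t k)) 1 (x (k + 1)) = x k}
  zero_mem' k := by simp
  add_mem' {x y} hx hy k := by simp only [Pi.add_apply, map_add, hx k, hy k]
  neg_mem' {x} hx k := by simp only [Pi.neg_apply, map_neg, hx k]

/-- Membership in the limit: compatibility under the successive reductions. [cite: Howard2004HeegnerKolyvagin, §2.2] -/
theorem mem_eisensteinH1LimitCarrier_iff (x : Π k : ℕ, galoisCohomology (κ.eisensteinTwist (ρ k) hm k) 1) :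
    x ∈ κ.eisensteinH1LimitCarrier ρ t hm ↔
      ∀ k, galoisCohomology.map (κ.eisensteinTwistReduce hm (Nat.le_succ k) (t k)) 1 (x (k + 1)) = x k :=
  Iff.rfl

/-- **The action of `f ∈ Λ` on the limit**: componentwise `H¹([f]_{A_{m,k}} •)` (functorial coefficient
action of `GaloisCohomologyScalarAction`), which preserves compatibility by `map_eisensteinTwistReduce_scalarMapH1`.
[cite: Howard2004HeegnerKolyvagin, §2.2 (H¹(K, T_𝔮) is an S_𝔮-module)] [cite: SerreGaloisCohomology1997, I §2.2] -/
def eisensteinH1LimitSMul (f : IwasawaAlgebra p) :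
    κ.eisensteinH1LimitCarrier ρ t hm →+ κ.eisensteinH1LimitCarrier ρ t hm where
  toFun x := ⟨fun k ↦ scalarMapH1 (κ.eisensteinTwist (ρ k) hm k) (κ.isScalarLinear_eisensteinTwist (ρ k) hm k)
      (Ideal.Quotient.mk _ f) ((x : Π k, galoisCohomology (κ.eisensteinTwist (ρ k) hm k) 1) k), fun k ↦ by
    rw [κ.map_eisensteinTwistReduce_scalarMapH1 hm (Nat.le_succ k) (t k) f, x.2 k]⟩
  map_zero' := Subtype.ext (funext fun _ ↦ map_zero _)
  map_add' x y := Subtype.ext (funext fun _ ↦ map_add _ _ _)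

/-- Coordinates of the action: `(f · x)_k = H¹([f]_k •) x_k = H¹(eisensteinTwistSMulHom … [f]_k) x_k`.
[cite: Howard2004HeegnerKolyvagin, §2.2] -/
@[simp]
theorem coe_eisensteinH1LimitSMul_apply (f : IwasawaAlgebra p) (x : κ.eisensteinH1LimitCarrier ρ t hm) (k : ℕ) :
    (κ.eisensteinH1LimitSMul ρ t hm f x : Π k, galoisCohomology (κ.eisensteinTwist (ρ k) hm k) 1) k =
      galoisCohomology.map (κ.eisensteinTwistSMulHom (ρ k) hm k (Ideal.Quotient.mk _ f)) 1
        ((x : Π k, galoisCohomology (κ.eisensteinTwist (ρ k) hm k) 1) k) :=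
  rfl

/-- **The `Λ`-MODULE structure on `lim_k H¹(K, M_k ⊗ A_{m,k}(ψ))`** (a `def`, installed only as the `module`
field of `eisensteinH1Limit`): `f • x := eisensteinH1LimitSMul f x`; axioms componentwise from
`scalarMapH1_one/_mul/_add/_zero`. [cite: Howard2004HeegnerKolyvagin, §2.2 and Def. 2.2.3] [cite: SerreGaloisCohomology1997, I §2.2] -/
@[reducible]
def eisensteinH1LimitModule : Module (IwasawaAlgebra p) (κ.eisensteinH1LimitCarrier ρ t hm) where
  smul f x := κ.eisensteinH1LimitSMul ρ t hm f x
  one_smul x := Subtype.ext (funext fun k ↦ by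
    change scalarMapH1 _ _ (Ideal.Quotient.mk _ (1 : IwasawaAlgebra p)) _ = _
    rw [map_one, scalarMapH1_one]; rfl)
  mul_smul f g x := Subtype.ext (funext fun k ↦ by
    change scalarMapH1 _ _ (Ideal.Quotient.mk _ (f * g)) _ = scalarMapH1 _ _ _ (scalarMapH1 _ _ _ _)
    rw [map_mul, scalarMapH1_mul]; rfl)
  smul_zero f := Subtype.ext (funext fun k ↦ map_zero _)
  smul_add f x y := Subtype.ext (funext fun k ↦ map_add _ _ _)
  add_smul f g x := Subtype.ext (funext fun k ↦ by
    change scalarMapH1 _ _ (Ideal.Quotient.mk _ (f + g)) _ = scalarMapH1 _ _ _ _ + scalarMapH1 _ _ _ _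
    rw [map_add, scalarMapH1_add]; rfl)
  zero_smul x := Subtype.ext (funext fun k ↦ by
    change scalarMapH1 _ _ (Ideal.Quotient.mk _ (0 : IwasawaAlgebra p)) _ = 0
    rw [map_zero, scalarMapH1_zero]; rfl)

/-- **The inhabitant: `lim_k H¹(K, M_k ⊗ A_{m,k}(ψ))` with its functorial `Λ`-action IS an `EisensteinH1Data`**
(`proj k` = evaluation; `proj_smul` by `rfl`, `proj_reduce` = membership, `ext`/`surj` tautological). For
`M_k = E[p^k]`, `κ ↦ κ.unitTwist (-1)`: Howard's `H¹(K, T_𝔮)` as an `S_𝔮`-module.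
[cite: Howard2004HeegnerKolyvagin, §2.2 and Def. 2.2.3 (H¹(K, T_𝔮) as an S_𝔮-module)] [cite: SerreGaloisCohomology1997, I §2.2 and II §1] -/
def eisensteinH1Limit : EisensteinH1Data κ ρ t hm where
  H := κ.eisensteinH1LimitCarrier ρ t hm
  addCommGroup := inferInstance
  module := κ.eisensteinH1LimitModule ρ t hm
  proj k := (Pi.evalAddMonoidHom (fun k ↦ galoisCohomology (κ.eisensteinTwist (ρ k) hm k) 1) k).comp
    (κ.eisensteinH1LimitCarrier ρ t hm).subtype
  proj_smul _ _ _ := rfl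
  proj_reduce k h := h.2 k
  ext _ hh := Subtype.ext (funext hh)
  surj x hx := ⟨⟨x, hx⟩, fun _ ↦ rfl⟩

/-- The projections of `eisensteinH1Limit` are the evaluations. [cite: Howard2004HeegnerKolyvagin, §2.2] -/
@[simp]
theorem eisensteinH1Limit_proj_apply (k : ℕ) (h : κ.eisensteinH1LimitCarrier ρ t hm) :
    (κ.eisensteinH1Limit ρ t hm).proj k h =
      (h : Π k, galoisCohomology (κ.eisensteinTwist (ρ k) hm k) 1) k :=
  rfl

/-- The underlying `Λ`-module of `eisensteinH1Limit` is the limit carrier. [cite: Howard2004HeegnerKolyvagin, §2.2] -/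
theorem eisensteinH1Limit_H : (κ.eisensteinH1Limit ρ t hm).H = ↥(κ.eisensteinH1LimitCarrier ρ t hm) :=
  rfl

/-- **`EisensteinH1Data κ ρ t hm` is inhabited** — statements `∀ D : EisensteinH1Data …` are non-vacuous.
[cite: Howard2004HeegnerKolyvagin, §2.2 and Def. 2.2.3] -/
theorem nonempty_eisensteinH1Data : Nonempty (EisensteinH1Data κ ρ t hm) :=
  ⟨κ.eisensteinH1Limit ρ t hm⟩

end Limit

end ZpExtension

end Literature.NumberTheory.EllipticCurves

end
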